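import Summits.HubbardSuperconductivity.HubbardSuperconductivity.Theorems.BalabanIRBirGroundStateAverageLRO
import Literature.MathematicalPhysics.QuantumLattice.FreeFermiGasNoPairFieldLRO

/-!
# Crux `BirGroundStateAverageLRO` (item `stmt-HubbardSuperconductivity-2079`): the `U = 0` endpoint

The crux (`Theses.BalabanIR.BirGroundStateAverageLRO`, route BalabanIR, target / rank 0) asks, on a
window of couplings `0 < U₁ < U < U₂`, eventually in even `L`, the ground-state-AVERAGE `d`-wave
pair LRO `c·L⁴·Re tr P ≤ Re tr (P Δ_d† Δ_d)` for the projection `P` onto the ground eigenspace of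
`hubbardTorus 2 L 1 U` in the sector `(2⌊(1-δ)L²/2⌋, S^z = 0)`.

Negative-side lemmas (nothing here asserts a Theses decl positively; every mutated statement is
spelled out, the inner predicate copied verbatim from the crux with `U := 0`):

* `re_trace_groundProj_mul_pairField_le_zeroCoupling` — at `U = 0` (`L ≥ 3`) the crux's right-hand
  side obeys an `L²` law: `Re tr (P Δ_d† Δ_d) ≤ 32 · L² · Re tr P`. Mechanism
  (`Literature/…/FreeFermiGasNoPairFieldLRO.lean`, basis-free, no Wick theorem): the free torus
  Hamiltonian is `Σ_{kσ} ε_L(k) n_{kσ}`, so the sector ground projection commutes with every Bloch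
  occupation number; against such a weight the cross pair correlations `tr (P b_k† b_{k'})`,
  `k ≠ k'`, vanish and `b_k† b_k = n_{k↑} n_{-k↓} ≤ 1`, whence
  `Re tr (P Δ_d†Δ_d) = 8 Σ_k ĝ_d(k)² Re tr (P n_{k↑}n_{-k↓}) ≤ 32 L² Re tr P`.
* `not_avgBound_zeroCoupling` / `exists_not_avgBound_zeroCoupling` — hence the crux's inequality is
  FALSE at `U = 0` for every `δ ≥ -1`, `c > 0` and every `L ≥ 3` with `c·L² > 32` (`Re tr P ≥ 1`,
  tree `one_le_re_trace_groundProj_hubbardTorus`); in particular for every `δ ∈ (0,1/2)`, `c > 0`,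
  `L₀` there is an even `L ≥ L₀` violating it. This DISCHARGES the sorried near-miss
  `not_avgBoundAt_zero_coupling` of the standing disprover's workfile
  (`Cruxes/BirGroundStateAverageLRO/Disproof.lean` §4, same statement with `AvgBoundAt` unfolded).
* `not_birGroundStateAverageLRO_at_zeroCoupling` — the crux's conclusion with the window replaced
  by the single coupling `U = 0` is false; `not_birGroundStateAverageLRO_window_through_zero` — the
  MUTATION of the crux whose window contains `0` (`U₁ < 0 < U₂` instead of `0 < U₁ < U₂`) is false.
  Together with `Negative/LoadBearing.lean` (window floor `η(c) ≤ U₁` modulo the BCS energy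
  inequality) this pins the role of `0 < U₁`: the free endpoint carries NO order at all, not merely
  a small constant.

Sources: Bardeen–Cooper–Schrieffer, Phys. Rev. 108 (1957) 1175, §II; C. N. Yang, Rev. Mod. Phys. 34
(1962) 694, §3 (no ODLRO for free fermions); Scalapino, Phys. Rep. 250 (1995) §2. Folklore
finite-dimensional statements; no named facts, no definitions.
-/

noncomputable section

namespace Summit.HubbardSuperconductivity.HubbardSuperconductivity.Theorems.BirGroundStateAverageLRO.Negative

open Matrix Finset Filter
open Literature.Probability.LatticeModels Literature.MathematicalPhysics.QuantumLattice
open Summit.HubbardSuperconductivity.HubbardSuperconductivity.Theorems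
open scoped ComplexOrder

/-- **The `U = 0` endpoint obeys an `L²` law.** For `L ≥ 3`, any `δ`, at coupling `U = 0` the
crux's data satisfy `Re tr (P Δ_d† Δ_d) ≤ 32 · L² · Re tr P` (`P` = projection onto the ground
eigenspace of the FREE torus Hamiltonian `hubbardTorus 2 L 1 0` in the sector
`(2⌊(1-δ)L²/2⌋, S^z = 0)`; the inner `let`s are the crux's, with `U := 0`).
Bardeen–Cooper–Schrieffer (1957) §II; Yang (1962) §3. [folklore] -/
theorem re_trace_groundProj_mul_pairField_le_zeroCoupling (L : ℕ) [NeZero L] (hL : 3 ≤ L) (δ : ℝ) :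
    let N : ℕ := 2 * ⌊(1 - δ) * (L : ℝ) ^ 2 / 2⌋₊
    let H := hubbardTorus 2 L 1 0
    let S := szSector (Λ := FermionTorus 2 L) N 0
    let E₀ := S ⊓ Module.End.eigenspace (Matrix.toLin' H) ((H.minEnergyOn S : ℝ) : ℂ)
    let P := projMatrix (E₀.map (Fock.toEuclidean (ι := Orb (FermionTorus 2 L)) :
      Fock (Orb (FermionTorus 2 L)) →ₗ[ℂ] EuclideanSpace ℂ (Finset (Orb (FermionTorus 2 L)))))
    (P * ((pairField dWaveFormFactor L)ᴴ * pairField dWaveFormFactor L)).trace.re ≤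
      32 * (L : ℝ) ^ 2 * P.trace.re := by
  intro N H S E₀ P
  exact re_trace_sectorEigenProj_mul_pairField_dWave_le_free hL N 0 _

/-- **The crux's inequality fails at `U = 0`.** For `δ ≥ -1`, `c > 0` and a side `L ≥ 3` with
`32 < c·L²`, the ground-state-average bound `c·L⁴·Re tr P ≤ Re tr (P Δ_d† Δ_d)` is FALSE for the
free torus Hamiltonian `hubbardTorus 2 L 1 0` (`Re tr P ≥ 1` and the `L²` law above). [folklore] -/
theorem not_avgBound_zeroCoupling (L : ℕ) [NeZero L] (hL : 3 ≤ L) {δ c : ℝ} (hδ : -1 ≤ δ)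
    (hcL : 32 < c * (L : ℝ) ^ 2) :
    ¬ (let N : ℕ := 2 * ⌊(1 - δ) * (L : ℝ) ^ 2 / 2⌋₊
       let H := hubbardTorus 2 L 1 0
       let S := szSector (Λ := FermionTorus 2 L) N 0
       let E₀ := S ⊓ Module.End.eigenspace (Matrix.toLin' H) ((H.minEnergyOn S : ℝ) : ℂ)
       let P := projMatrix (E₀.map (Fock.toEuclidean (ι := Orb (FermionTorus 2 L)) :
         Fock (Orb (FermionTorus 2 L)) →ₗ[ℂ] EuclideanSpace ℂ (Finset (Orb (FermionTorus 2 L)))))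
       c * (L : ℝ) ^ 4 * P.trace.re ≤
         (P * ((pairField dWaveFormFactor L)ᴴ * pairField dWaveFormFactor L)).trace.re) := by
  intro h
  have hup := re_trace_groundProj_mul_pairField_le_zeroCoupling L hL δ
  have hP := one_le_re_trace_groundProj_hubbardTorus L 1 0 δ hδ
  simp only at h hup hP
  have hL2 : (0 : ℝ) < (L : ℝ) ^ 2 := by
    have : (0 : ℝ) < (L : ℝ) := by exact_mod_cast Nat.pos_of_ne_zero (NeZero.ne L)
    positivity
  have h4 : (L : ℝ) ^ 4 = (L : ℝ) ^ 2 * (L : ℝ) ^ 2 := by ring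
  rw [h4] at h
  -- `c L² · (L² tr P) ≤ 32 · (L² tr P)` with `L² tr P > 0`
  have hpos : 0 < (L : ℝ) ^ 2 * _ := mul_pos hL2 (lt_of_lt_of_le one_pos hP)
  nlinarith

/-- **Discharge of the disprover's `U = 0` near-miss** (`Cruxes/…/Disproof.lean` §4,
`not_avgBoundAt_zero_coupling`, same statement with `AvgBoundAt δ 0 c L` unfolded): for every
`δ ∈ (0,1/2)`, `c > 0` and `L₀` there is an even side `L ≥ L₀` at which the crux's inequality fails
at coupling `U = 0` (take `L = 2·max(L₀, ⌈32/c⌉ + 2)`). [folklore] -/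
theorem exists_not_avgBound_zeroCoupling (δ c : ℝ) (hδ : δ ∈ Set.Ioo (0:ℝ) (1/2)) (hc : 0 < c)
    (L₀ : ℕ) :
    ∃ (L : ℕ) (_ : NeZero L), L₀ ≤ L ∧ Even L ∧
      ¬ (let N : ℕ := 2 * ⌊(1 - δ) * (L : ℝ) ^ 2 / 2⌋₊
         let H := hubbardTorus 2 L 1 0
         let S := szSector (Λ := FermionTorus 2 L) N 0
         let E₀ := S ⊓ Module.End.eigenspace (Matrix.toLin' H) ((H.minEnergyOn S : ℝ) : ℂ)
         let P := projMatrix (E₀.map (Fock.toEuclidean (ι := Orb (FermionTorus 2 L)) :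
           Fock (Orb (FermionTorus 2 L)) →ₗ[ℂ] EuclideanSpace ℂ (Finset (Orb (FermionTorus 2 L)))))
         c * (L : ℝ) ^ 4 * P.trace.re ≤
           (P * ((pairField dWaveFormFactor L)ᴴ * pairField dWaveFormFactor L)).trace.re) := by
  set m : ℕ := max L₀ (⌈32 / c⌉₊ + 2) with hm
  have hm0 : ⌈32 / c⌉₊ + 2 ≤ m := le_max_right _ _
  have hmL : L₀ ≤ m := le_max_left _ _
  haveI : NeZero (2 * m) := ⟨by omega⟩
  refine ⟨2 * m, inferInstance, by omega, even_two_mul m, ?_⟩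
  refine not_avgBound_zeroCoupling (2 * m) (by omega) (by linarith [hδ.1]) ?_
  -- `32 < c · (2m)²`: `2m ≥ ⌈32/c⌉ + 2 > 32/c` and `(2m)² ≥ 2m`
  have hceil : (32 / c : ℝ) ≤ (⌈32 / c⌉₊ : ℝ) := Nat.le_ceil _
  have hmR : (⌈32 / c⌉₊ : ℝ) + 2 ≤ ((2 * m : ℕ) : ℝ) := by
    have : ⌈32 / c⌉₊ + 2 ≤ 2 * m := by omega
    exact_mod_cast this
  have hge1 : (1 : ℝ) ≤ ((2 * m : ℕ) : ℝ) := by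
    have : 1 ≤ 2 * m := by omega
    exact_mod_cast this
  have hsq : ((2 * m : ℕ) : ℝ) ≤ ((2 * m : ℕ) : ℝ) ^ 2 := by nlinarith
  have hdiv : 32 / c < ((2 * m : ℕ) : ℝ) := by linarith
  have h32 : 32 < c * ((2 * m : ℕ) : ℝ) := by
    have := (div_lt_iff₀ hc).1 hdiv
    linarith
  nlinarith

/-- **The crux's conclusion fails at the single coupling `U = 0`.** There are NO `δ ∈ (0,1/2)`,
`c > 0`, `L₀` such that the ground-state-average bound of `BirGroundStateAverageLRO` holds at
`U = 0` for all even `L ≥ L₀`: the free Fermi gas has no sector-average `d`-wave pair LRO. (The crux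
itself asks `0 < U₁`, so this is the excluded endpoint, now settled unconditionally.) [folklore] -/
theorem not_birGroundStateAverageLRO_at_zeroCoupling :
    ¬ (∃ δ ∈ Set.Ioo (0:ℝ) (1/2), ∃ c : ℝ, 0 < c ∧ ∃ L₀ : ℕ, ∀ (L : ℕ) [NeZero L], L₀ ≤ L → Even L →
        let N : ℕ := 2 * ⌊(1 - δ) * (L : ℝ) ^ 2 / 2⌋₊
        let H := hubbardTorus 2 L 1 0
        let S := szSector (Λ := FermionTorus 2 L) N 0
        let E₀ := S ⊓ Module.End.eigenspace (Matrix.toLin' H) ((H.minEnergyOn S : ℝ) : ℂ)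
        let P := projMatrix (E₀.map (Fock.toEuclidean (ι := Orb (FermionTorus 2 L)) :
          Fock (Orb (FermionTorus 2 L)) →ₗ[ℂ] EuclideanSpace ℂ (Finset (Orb (FermionTorus 2 L)))))
        c * (L : ℝ) ^ 4 * P.trace.re ≤
          (P * ((pairField dWaveFormFactor L)ᴴ * pairField dWaveFormFactor L)).trace.re) := by
  rintro ⟨δ, hδ, c, hc, L₀, h⟩
  obtain ⟨L, hL, hL₀, hLe, hnot⟩ := exists_not_avgBound_zeroCoupling δ c hδ hc L₀
  exact hnot (h L hL₀ hLe)

/-- **Refuted mutation: a window THROUGH `0`.** The variant of `BirGroundStateAverageLRO` in which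
the coupling window contains `U = 0` (`U₁ < 0 < U₂` in place of `0 < U₁ < U₂`, everything else
verbatim) is FALSE: `U = 0` lies in the window and carries no order. So the crux's side condition
`0 < U₁` cannot be relaxed to admit the free point (compare `Negative/LoadBearing.lean`: with
`0 ≤ U₁` the admissible constant degrades as `U₁ → 0⁺`, conditionally on the BCS energy
inequality; the endpoint itself is excluded unconditionally here). [folklore] -/
theorem not_birGroundStateAverageLRO_window_through_zero :
    ¬ (∃ δ ∈ Set.Ioo (0:ℝ) (1/2), ∃ U₁ U₂ c : ℝ, U₁ < 0 ∧ 0 < U₂ ∧ 0 < c ∧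
      ∀ U ∈ Set.Ioo U₁ U₂, ∃ L₀ : ℕ, ∀ (L : ℕ) [NeZero L], L₀ ≤ L → Even L →
        let N : ℕ := 2 * ⌊(1 - δ) * (L : ℝ) ^ 2 / 2⌋₊
        let H := hubbardTorus 2 L 1 U
        let S := szSector (Λ := FermionTorus 2 L) N 0
        let E₀ := S ⊓ Module.End.eigenspace (Matrix.toLin' H) ((H.minEnergyOn S : ℝ) : ℂ)
        let P := projMatrix (E₀.map (Fock.toEuclidean (ι := Orb (FermionTorus 2 L)) :
          Fock (Orb (FermionTorus 2 L)) →ₗ[ℂ] EuclideanSpace ℂ (Finset (Orb (FermionTorus 2 L)))))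
        c * (L : ℝ) ^ 4 * P.trace.re ≤
          (P * ((pairField dWaveFormFactor L)ᴴ * pairField dWaveFormFactor L)).trace.re) := by
  rintro ⟨δ, hδ, U₁, U₂, c, hU₁, hU₂, hc, h⟩
  obtain ⟨L₀, hL₀⟩ := h 0 ⟨hU₁, hU₂⟩
  exact not_birGroundStateAverageLRO_at_zeroCoupling ⟨δ, hδ, c, hc, L₀, fun L _ hL hLe => hL₀ L hL hLe⟩

/-- **Registered stub `zeroCouplingNoAverageLRO` (crux `stmt-HubbardSuperconductivity-2079`).** The
disprover's `U = 0` near-miss as a one-line registered statement: for every `δ ∈ (0,1/2)`, `c > 0`,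
`L₀` there is an even `L ≥ L₀` at which the crux's ground-state-average bound fails for the FREE
torus Hamiltonian (`exists_not_avgBound_zeroCoupling`). [folklore] -/
theorem zeroCouplingNoAverageLRO : ∀ (δ c : ℝ), δ ∈ Set.Ioo (0:ℝ) (1/2) → 0 < c → ∀ L₀ : ℕ, ∃ (L : ℕ) (_ : NeZero L), L₀ ≤ L ∧ Even L ∧ ¬ (let N : ℕ := 2 * ⌊(1 - δ) * (L : ℝ) ^ 2 / 2⌋₊; let H := Literature.MathematicalPhysics.QuantumLattice.hubbardTorus 2 L 1 0; let S := Literature.MathematicalPhysics.QuantumLattice.szSector (Λ := Literature.MathematicalPhysics.QuantumLattice.FermionTorus 2 L) N 0; let E₀ := S ⊓ Module.End.eigenspace (Matrix.toLin' H) ((H.minEnergyOn S : ℝ) : ℂ); let P := Literature.MathematicalPhysics.QuantumLattice.projMatrix (E₀.map (Literature.MathematicalPhysics.QuantumLattice.Fock.toEuclidean (ι := Literature.MathematicalPhysics.QuantumLattice.Orb (Literature.MathematicalPhysics.QuantumLattice.FermionTorus 2 L)) : Literature.MathematicalPhysics.QuantumLattice.Fock (Literature.MathematicalPhysics.QuantumLattice.Orb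 (Literature.MathematicalPhysics.QuantumLattice.FermionTorus 2 L)) →ₗ[ℂ] EuclideanSpace ℂ (Finset (Literature.MathematicalPhysics.QuantumLattice.Orb (Literature.MathematicalPhysics.QuantumLattice.FermionTorus 2 L))))); c * (L : ℝ) ^ 4 * P.trace.re ≤ (P * (Matrix.conjTranspose (Literature.MathematicalPhysics.QuantumLattice.pairField Literature.MathematicalPhysics.QuantumLattice.dWaveFormFactor L) * Literature.MathematicalPhysics.QuantumLattice.pairField Literature.MathematicalPhysics.QuantumLattice.dWaveFormFactor L)).trace.re) :=
  fun δ c hδ hc L₀ => exists_not_avgBound_zeroCoupling δ c hδ hc L₀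

end Summit.HubbardSuperconductivity.HubbardSuperconductivity.Theorems.BirGroundStateAverageLRO.Negative
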